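import Literature.MathematicalPhysics.QuantumFieldTheory.Balaban1983to89.B9SupplySockB9P3ZdSrcPer
import Literature.MathematicalPhysics.QuantumFieldTheory.Balaban1983to89.B9Thm33SocketUniformLevelsZdPer
import Literature.MathematicalPhysics.QuantumFieldTheory.Balaban1983to89.B9Eq321LandauOrthogonalZdPer

/-!
# `Balaban1983to89.B9Thm33SourceWitnessZdPer` — THE SOURCE TERM `G(U₀)·D R^per(U₀) D*·A` OF [B8] (1.58) ON THE TORUS, PER MEMBER: under the Landau
# relation with source (1.146) `R^per(U₀)D*A = R^per(U₀)f`, the projection is an `L²(T_P)`-contraction, hence `|D R^per f|₍₋₃₎ ≤ c·|f|₍₋₂₎` with a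
# per-torus constant, and the SOURCE BINDERS `SrcAtIPer` ∕ `SrcHolderAtIH2Per` of `B9SupplySockB9P3ZdSrcPer` are THEOREMS for the genuine record at the
# torus member — the sourced periodic socket `SB9srcH2Per` of dag-n05-c's T6e fully fed at `torusIdx`

statement-level skeleton of published theorems with citation tags; proofs where landed; nothing here is a claim about the
Yang–Mills mass gap

`[Balaban1985BackgroundPropagators]` ("B9", CMP **99**) (3.20)–(3.22) p. 394 (`R(U₀)` the orthogonal projection onto `Δ^η_{U₀}N(Q′)`), (3.26)–(3.27)
p. 395, (3.42) p. 397, (3.43)–(3.47) p. 398, Thm 3.3 p. 399, Thm 3.11 p. 416, p. 390 («|X|² = tr X*X»).  `[Balaban1985RegularSpaces]` ("B8", CMP **98**) Thm 8 + (1.146)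
p. 101 (the source `f`), (1.58)–(1.59) p. 86, Prop. 3 p. 87, p. 92, p. 77 *«we admit the case where some domains Ω_j are equal to T_η»*.
PDF held: `paper:balaban1985-cmp99-background-propagators` pp. 394–399.

CITATION HEADER (lean-in-tree rule).  Cell `pub-ymgap` (YM Track A), DAG node N06 = [B9], seat `pub-ymgap-dag-n06-b` (g24), the (β′-PERIODIC) road; the
object-side sequel of this seat's `B9SupplySockB9P3ZdSrcPer` (FILE 5: the binder-level supplier of dag-n05-c T6e's `SB9srcH2Per`).  WHAT PRINT DOES: in
[B8] (1.58) with a source ((1.146), Thm 8 p. 101) the extra term is `G(U₀) D R(U₀) D* A′` and `R(U₀)D*A′ = R(U₀)f` because `Δ_{U₀}(D*A′ − f) ∈ Q′ᵀ(·)`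
is orthogonal to `Δ_{U₀}N(Q′)` ((3.20)–(3.22)); its size is read off (3.42)₃ ∕ (3.47).  HERE, per torus: `R^per(U₀)` is `formPer`-orthogonal (dag-n06-w4
`B9Eq321LandauProjectionZdPer`), so `⟨Rf, Rf⟩ ≤ ⟨f, f⟩`; with the fibre comparison `κ‖a‖² ≤ Re τ(a*a)`, `|Re τ(x*y)| ≤ C_τ‖x‖‖y‖` on the `Pᵈ` sites of
the cell, `‖(R^per f)(x)‖ ≤ K·sup‖f‖`, `K = max{1, Pᵈ·C_τ∕κ}` — uniformly in the background `U₀`; then `|D R^per f|₍₋₃₎ ≤ 2K·L^{3m}·|f|₍₋₂₎` at a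
member with `Ω_j = ℤᵈ`, and FILE 3's `GlobAtIPer` ∕ Hölder binders at `J := D R^per f ∈ E_𝔤^per(P)` give the source binders.  Tools BY NAME: w4's
`sum_box_pair_covLap_eq_zero_of_multiplier`, `projEPer_*`, `formPer_*`; g22's `projRPerLin`, `DRDs_mem_domSubHPer`, `gop_isPeriodic`; this seat's g24
`globAtIPer_opsAllZdPer_torusIdx`, `invAtHIPer_opsAllZdPer_torusIdx`, `exists_norm_sq_le_re_trace`.  Nothing is re-declared.

WHAT IS PROVED (kernel, 0 sorry; no `def`, no `instance`, no `notation`).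
* §1 (the projection is a contraction) `re_trace_star_mul_self_nonneg`, ★ `formPer_projEPer_self_le` (Bessel: `⟨Rf, Rf⟩ ≤ ⟨f, f⟩`), `mul_norm_sq_le_formPer_self`
  (`κ‖f(x)‖² ≤ ⟨f, f⟩`), `formPer_self_le_card_mul` (`⟨f, f⟩ ≤ Pᵈ·C_τ·F²` if `‖f‖ ≤ F`), ★★ `norm_projRPer_le` (`‖(R^per(U₀)f)(x)‖ ≤ max{1, Pᵈ C_τ∕κ}·F`,
  EVERY background `U₀`).
* §2 (the source enters through `R^per`) ★ `mem_orthogonal_rangeSubPer_of_multiplier` (`Δ^η_{U₀}φ = Q′ᵀμ` on the cell, `φ` periodic ⟹ `φ ⊥ Δ^η_{U₀}N^per(Q′)`),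
  ★ `projRPer_eq_zero_of_multiplier`, ★★ `projRPer_covDivB_eq_projRPer_of_src` ((1.146) at `Ω₀ = ℤᵈ` ⟹ `R^per(U₀)D*A = R^per(U₀)f`),
  `DRDs_opsAllZdPer_eq_of_src` (the record's letter: `D R^per D* A = D R^per f`).
* §3 (the size of the source letter) `norm_le_of_bdd_neg_two_univ` (`‖f(x)‖ ≤ η⁻²|f|₍₋₂₎`), ★ `norm_DRDs_le_of_src` (`‖(D R^per f)(b)‖ ≤ 2η⁻³K|f|₍₋₂₎`),
  ★★ `bondNorm_DRDs_le_of_src` (`|D R^per D* A|₍₋₃₎ ≤ 2K(Lᵐ)³·|f|₍₋₂₎` at a member with `Ω_j = ℤᵈ`).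
* §4 (binders from binders, generic record `opsAllZdPer τ L P ΛbP ops₀`, member with `Ω_j = ℤᵈ`, `Lᵐ ∣ P`) ★★★ `srcAtIPer_of_globAtIPer_univ`
  (`GlobAtIPer aT B₀ ⟹ SrcAtIPer aT (B₀·2K(Lᵐ)³)`), ★★★ `srcHolderAtIH2Per_of_globAtIPer_univ` (`GlobAtIPer aT B₀ ⟹ SrcHolderAtIH2Per aT (2B₀(Lᵐ)^β·2K(Lᵐ)³) β len`,
  `0 ≤ β`, integer lengths).
* §5 (at the torus member) ★★★ `srcAtIPer_opsAllZdPer_torusIdx` ∕ `srcHolderAtIH2Per_opsAllZdPer_torusIdx` (`∃ aS > 0, ∃ c ≥ 0`: the two source binders for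
  the genuine record at `torusIdx`, NO binder of Bałaban's left), ★★★★ `srcBinders_opsAllZdPer_torusIdx` (all five analytic binders at once with ONE
  threshold), ★★★★★ `sockB9P3srcH2Per_genuine_torusIdx` (dag-n05-c T6e's `SB9srcH2Per` text for the genuine record at the torus member, fully fed).

HONEST SCOPE.  (i) Constants per torus (`K = max{1, Pᵈ C_τ∕κ}`; `B₀`, thresholds by compactness, FILES 2–3): NOT print's uniform (3.42)–(3.47); volume
uniformity NOT proved (WATCH-QUAL-SOCKET-TORUS).  (ii) NO estimate of [B9] beyond finite-dimensional linear algebra on the period cell is asserted.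
(iii) Count-neutral; N05 ∕ N06 NOT discharged; K1⁹ `stmt-QuantumFields-27364` NOT closed; one finite `𝕋⁴` programme at fixed `ε`, Bałaban as printed; R4
closes only the conditional finite-`𝕋⁴` rung `BalabanLadder.UV` — nothing continuum ∕ ℝ⁴ ∕ OS ∕ mass gap ∕ Clay.  Unit `pub-ymgap-dag-n06-b` (g24), 2026-08-28.
-/

noncomputable section

namespace Literature.MathematicalPhysics.QuantumFieldTheory.Balaban1983to89.B9Thm33SourceWitnessZdPer

open B7Prop1Explicit B7Prop2Explicit
open B7Prop1Local (InBox loK bondHiK)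
open B7Prop4GeneralLevels (linCovIter)
open B8Ineq132 (covDerivFwd covDeriv InAk BondTouches)
open B8Eq184Proof (cfgExp)
open B8Lemma1NonAbelian (mulCfg)
open B8Eq140Level (SideTouches)
open B8Eq146AExpansion (iEta plaqCovDeriv)
open B8Eq143PlaqExpansion (pdiv)
open B8Eq155JBound (Jcur wsup)
open B8ScaledSupNorm (bondNorm msup weight Bdd)
open B8Eq138LandauZd (IsLandau138 IsLandau146W InR138 covLap covDivB QT logCfg)
open B8LeafModelZd (ZdIdx)
open B9Eq340HolderZd (hquot AdmPair trans hquot_nonneg)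
open B9SupplySockB9P3ZdLetters (OpsZd deltaAOf)
open B9SupplySockB9P3ZdLettersOmega (OnDom norm_covDerivFwd_le)
open B9SupplySockB9P3ZdGammaInAkDpZd (withDpZd)
open B9Eq316AveragingTransposeZd (betaTau qQ)
open B9Eq316AveragingTransposeZdPrinted (withQQP)
open B9Eq327GreenZdHermPer (domSubHPer mem_domSubHPer_iff InvAtHIPer isPeriodic_apply_dir)
open B9SupplySockB9P3ZdPer (GlobAtIPer)
open B9SupplySockB9P3ZdH2Per (HolderAtIH2Per)
open B9SupplySockB9P3ZdAllLettersZdPer (opsAllZdPer opsLandauPer opsAllZdPer_DRDs DRDs_mem_domSubHPer projRPerLin projRPerLin_apply isPeriodic_projRPer)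
open B9SupplySockB9P3ZdSrcPer (SrcAtIPer SrcHolderAtIH2Per sockB9P3srcH2Per_opsAllZdPer_of_binders)
open B9Eq321LandauProjectionZdPer (perSub formPer formPer_apply projEPer projRPer rangeSubPer perRestrict perRestrict_mem_perSub perRestrict_eq_self
  isCompl_rangeSubPer_orthogonal projEPer_eq_projection projEPer_apply_mem_range formPer_isSymm projEPer_apply_of_mem_orthogonal)
open B9Eq321LandauProjectionZd (star_covLap_of_isSelfAdjoint)
open B9Eq321LandauOrthogonalZd (trace_mul_conjR)
open B9Eq321LandauOrthogonalZdPer (sum_box_pair_covLap_eq_zero_of_multiplier)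
open B9Thm33GlobalBlockWitnessCubeZd (exists_norm_sq_le_re_trace)
open B9Thm33GlobalBlockWitnessZdPer (globAtIPer_opsAllZdPer_torusIdx gop_isPeriodic_opsAllZdPer')
open B9Thm311ClassCompactnessZdPer (invAtHIPer_opsAllZdPer_torusIdx)
open B8Thm4TorusAt (torusLam mem_torusLam_iff)
open B8Thm2TorusMember (TorusMember torusIdx torusLamb mem_torusLamb_iff)
open T4TermwiseTorus (IsPeriodic box tlift tcls card_box tlift_mem_box)

-- `Site` alone could resolve to the torus sites of `Setup.lean`; re-export the `ℤ^d` sites of `B7Prop1Explicit`.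
export B7Prop1Explicit (Site)

variable {d : ℕ} {𝔸 : Type*} [CStarAlgebra 𝔸]

/-! ## §1  `R^per(U₀)` is an `L²(T_P)`-contraction, hence sup-norm bounded by a per-torus constant -/

section Contraction

variable (τ : 𝔸 →ₗ[ℂ] ℂ) (P : ℕ)

omit [CStarAlgebra 𝔸] in
/-- `Re τ(a*a) ≥ 0` for a faithful positive `τ`. [cite: Balaban1985BackgroundPropagators, p.390 («|X|² = tr X*X»)] -/
theorem re_trace_star_mul_self_nonneg {𝔸 : Type*} [Ring 𝔸] [StarRing 𝔸] [Algebra ℂ 𝔸] (τ : 𝔸 →ₗ[ℂ] ℂ)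
    (hτp : ∀ a : 𝔸, a ≠ 0 → 0 < (τ (star a * a)).re) (a : 𝔸) : 0 ≤ (τ (star a * a)).re := by
  by_cases h : a = 0
  · rw [h, mul_zero, map_zero, Complex.zero_re]
  · exact (hτp a h).le

variable {L m : ℕ} {η : ℝ} {Λs : ℕ → Set (Site d)} {U₀ : Site d → Fin d → 𝔸ˣ}

/-- ★ **BESSEL FOR `R^per(U₀)`**: `⟨R f, R f⟩ ≤ ⟨f, f⟩` in `L²(T_P, ·)` — `f = Rf + (f − Rf)` with `f − Rf ⊥ R ∋ Rf` and `⟨g, g⟩ ≥ 0` (faithful Hermitian `τ`,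
finite-dimensional fibre, `P ≠ 0`; EVERY background `U₀`). [cite: Balaban1985BackgroundPropagators, (3.21)–(3.22) p.394 («R(U) … the orthogonal projection»)] -/
theorem formPer_projEPer_self_le [FiniteDimensional ℝ 𝔸] [NeZero P] (hτs : ∀ a : 𝔸, τ (star a) = starRingEnd ℂ (τ a))
    (hτp : ∀ a : 𝔸, a ≠ 0 → 0 < (τ (star a * a)).re) (f : perSub (𝔸 := 𝔸) (d := d) P) :
    formPer τ P (projEPer τ P L m η Λs U₀ f) (projEPer τ P L m η Λs U₀ f) ≤ formPer τ P f f := by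
  have hc := isCompl_rangeSubPer_orthogonal (P := P) (τ := τ) L m η Λs U₀ hτs hτp
  set R := projEPer τ P L m η Λs U₀ with hR
  have hRf : R f ∈ rangeSubPer P L m η Λs U₀ := projEPer_apply_mem_range L m η Λs U₀ hτs hτp f
  have hres : f - R f ∈ (formPer τ P).orthogonal (rangeSubPer P L m η Λs U₀) := by
    rw [hR, projEPer_eq_projection L m η Λs U₀ hτs hτp]
    exact Submodule.sub_projection_mem hc f
  have h0 : formPer τ P (R f) (f - R f) = 0 := (LinearMap.BilinForm.mem_orthogonal_iff.1 hres) _ hRf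
  have h0' : formPer τ P (f - R f) (R f) = 0 := by rw [(formPer_isSymm τ P hτs).eq (f - R f) (R f), h0]
  have hnn : 0 ≤ formPer τ P (f - R f) (f - R f) := by
    rw [formPer_apply]
    exact Finset.sum_nonneg fun x _ => re_trace_star_mul_self_nonneg τ hτp _
  calc formPer τ P (R f) (R f) ≤ formPer τ P (R f) (R f) + formPer τ P (f - R f) (f - R f) := le_add_of_nonneg_right hnn
    _ = formPer τ P (R f + (f - R f)) (R f + (f - R f)) := by
        simp only [map_add, LinearMap.add_apply, h0, h0']; ring
    _ = formPer τ P f f := by rw [add_sub_cancel]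

/-- `κ‖f(x)‖² ≤ ⟨f, f⟩_{T_P}` for a periodic `f` when `κ‖a‖² ≤ Re τ(a*a)` on the fibre (the single site `x mod P` of the cell).
[cite: Balaban1985BackgroundPropagators, (3.21) p.394, p.390 («|X|² = tr X*X»)] -/
theorem mul_norm_sq_le_formPer_self [NeZero P] {κ : ℝ} (hκle : ∀ a : 𝔸, κ * ‖a‖ ^ 2 ≤ (τ (star a * a)).re)
    (hτp : ∀ a : 𝔸, a ≠ 0 → 0 < (τ (star a * a)).re) (f : perSub (𝔸 := 𝔸) (d := d) P) (x : Site d) :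
    κ * ‖(f : Site d → 𝔸) x‖ ^ 2 ≤ formPer τ P f f := by
  rw [formPer_apply]
  have hx : (f : Site d → 𝔸) (tlift (tcls P x)) = (f : Site d → 𝔸) x := IsPeriodic.apply_tlift f.2 x
  calc κ * ‖(f : Site d → 𝔸) x‖ ^ 2 ≤ (τ (star ((f : Site d → 𝔸) x) * (f : Site d → 𝔸) x)).re := hκle _
    _ = (τ (star ((f : Site d → 𝔸) (tlift (tcls P x))) * (f : Site d → 𝔸) (tlift (tcls P x)))).re := by rw [hx]
    _ ≤ ∑ y ∈ box (d := d) P, (τ (star ((f : Site d → 𝔸) y) * (f : Site d → 𝔸) y)).re :=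
        Finset.single_le_sum (f := fun y => (τ (star ((f : Site d → 𝔸) y) * (f : Site d → 𝔸) y)).re)
          (fun y _ => re_trace_star_mul_self_nonneg τ hτp _) (tlift_mem_box _)

/-- `⟨f, f⟩_{T_P} ≤ Pᵈ·C_τ·F²` when `‖f‖ ≤ F` on the cell and `|Re τ(x*y)| ≤ C_τ‖x‖‖y‖`. [cite: Balaban1985BackgroundPropagators, (3.17) p.393, p.390] -/
theorem formPer_self_le_card_mul [Nontrivial 𝔸] {Cτ : ℝ} (hCτ : ∀ x y : 𝔸, |(τ (star x * y)).re| ≤ Cτ * ‖x‖ * ‖y‖)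
    (f : perSub (𝔸 := 𝔸) (d := d) P) {F : ℝ} (hF : ∀ x, ‖(f : Site d → 𝔸) x‖ ≤ F) :
    formPer τ P f f ≤ ((box (d := d) P).card : ℝ) * (Cτ * F ^ 2) := by
  have hCτ0 : 0 ≤ Cτ := by
    have h := hCτ 1 1
    rw [star_one, one_mul, norm_one, mul_one, mul_one] at h
    exact le_trans (abs_nonneg _) h
  have hF0 : 0 ≤ F := (norm_nonneg _).trans (hF 0)
  rw [formPer_apply]
  calc ∑ x ∈ box (d := d) P, (τ (star ((f : Site d → 𝔸) x) * (f : Site d → 𝔸) x)).re ≤ ∑ _x ∈ box (d := d) P, Cτ * F ^ 2 :=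
        Finset.sum_le_sum fun x _ => (le_abs_self _).trans ((hCτ _ _).trans (by
          rw [sq, ← mul_assoc]
          exact mul_le_mul (mul_le_mul_of_nonneg_left (hF x) hCτ0) (hF x) (norm_nonneg _) (mul_nonneg hCτ0 hF0)))
    _ = ((box (d := d) P).card : ℝ) * (Cτ * F ^ 2) := by rw [Finset.sum_const, nsmul_eq_mul]

/-- ★★ **`R^per(U₀)` IS SUP-NORM BOUNDED BY A PER-TORUS CONSTANT, UNIFORMLY IN THE BACKGROUND**: `‖(R^per(U₀)f)(x)‖ ≤ max{1, Pᵈ·C_τ∕κ}·F` whenever `‖f‖ ≤ F`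
(faithful Hermitian `τ` with `κ‖a‖² ≤ Re τ(a*a)` and `|Re τ(x*y)| ≤ C_τ‖x‖‖y‖`; f.d. fibre; `P ≠ 0`; ANY `U₀`, `L`, `m`, `η`, `Λs`) — Bessel + the two fibre
comparisons on the `Pᵈ` sites of the cell. [cite: Balaban1985BackgroundPropagators, (3.21)–(3.22) p.394, (3.17) p.393, p.390] -/
theorem norm_projRPer_le [FiniteDimensional ℝ 𝔸] [Nontrivial 𝔸] [NeZero P] (hτs : ∀ a : 𝔸, τ (star a) = starRingEnd ℂ (τ a))
    (hτp : ∀ a : 𝔸, a ≠ 0 → 0 < (τ (star a * a)).re) {Cτ : ℝ} (hCτ : ∀ x y : 𝔸, |(τ (star x * y)).re| ≤ Cτ * ‖x‖ * ‖y‖)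
    {κ : ℝ} (hκ : 0 < κ) (hκle : ∀ a : 𝔸, κ * ‖a‖ ^ 2 ≤ (τ (star a * a)).re)
    (L m : ℕ) (η : ℝ) (Λs : ℕ → Set (Site d)) (U₀ : Site d → Fin d → 𝔸ˣ) (f : Site d → 𝔸) {F : ℝ} (hF : ∀ x, ‖f x‖ ≤ F) (x : Site d) :
    ‖projRPer τ P L m η Λs U₀ f x‖ ≤ max 1 (((box (d := d) P).card : ℝ) * Cτ / κ) * F := by
  set K : ℝ := max 1 (((box (d := d) P).card : ℝ) * Cτ / κ) with hK
  have hK1 : 1 ≤ K := le_max_left _ _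
  have hF0 : 0 ≤ F := (norm_nonneg _).trans (hF 0)
  set f' : perSub (𝔸 := 𝔸) (d := d) P := ⟨perRestrict P f, perRestrict_mem_perSub P f⟩ with hf'
  have hf'F : ∀ y, ‖(f' : Site d → 𝔸) y‖ ≤ F := fun y => hF _
  have h1 : κ * ‖projRPer τ P L m η Λs U₀ f x‖ ^ 2 ≤ formPer τ P (projEPer τ P L m η Λs U₀ f') (projEPer τ P L m η Λs U₀ f') :=
    mul_norm_sq_le_formPer_self τ P hκle hτp _ x
  have h2 := formPer_projEPer_self_le τ P hτs hτp f' (L := L) (m := m) (η := η) (Λs := Λs) (U₀ := U₀)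
  have h3 := formPer_self_le_card_mul τ P hCτ f' hf'F
  have h123 : κ * ‖projRPer τ P L m η Λs U₀ f x‖ ^ 2 ≤ ((box (d := d) P).card : ℝ) * (Cτ * F ^ 2) := h1.trans (h2.trans h3)
  have hdiv : ‖projRPer τ P L m η Λs U₀ f x‖ ^ 2 ≤ ((box (d := d) P).card : ℝ) * Cτ / κ * F ^ 2 := by
    rw [div_mul_eq_mul_div, le_div_iff₀ hκ]
    linarith
  have hKsq : ((box (d := d) P).card : ℝ) * Cτ / κ ≤ K ^ 2 := (le_max_right _ _).trans (by nlinarith)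
  have hsq : ‖projRPer τ P L m η Λs U₀ f x‖ ^ 2 ≤ (K * F) ^ 2 :=
    calc _ ≤ ((box (d := d) P).card : ℝ) * Cτ / κ * F ^ 2 := hdiv
      _ ≤ K ^ 2 * F ^ 2 := mul_le_mul_of_nonneg_right hKsq (sq_nonneg _)
      _ = (K * F) ^ 2 := by ring
  exact (pow_le_pow_iff_left₀ (norm_nonneg _) (by positivity) two_ne_zero).1 hsq

end Contraction

/-! ## §2  The source enters through `R^per(U₀)`: `R^per(U₀)D*A = R^per(U₀)f` under the Landau relation (1.146) -/

section Source

variable {τ : 𝔸 →ₗ[ℂ] ℂ} {P L m : ℕ} [NeZero P] [NeZero L] {η : ℝ} {Λs : ℕ → Set (Site d)} {U₀ : Site d → Fin d → 𝔸ˣ}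

/-- ★ **A PERIODIC SOLUTION OF THE MULTIPLIER EQUATION IS ORTHOGONAL TO `Δ^η_{U₀}N^per(Q′(U₀))`**: `τ` tracial, `U₀` unitary `P`-periodic, `Lᵐ ∣ P`, `φ`
periodic with `Δ^η_{U₀}φ = Q′(U₀)ᵀμ` on the cell ⟹ `φ ∈ R(U₀)^⊥` for `formPer τ P` — w4's `sum_box_pair_covLap_eq_zero_of_multiplier` for the tracial pairing,
then `(Δ^η_{U₀}λ)* = Δ^η_{U₀}λ` and the span. [cite: Balaban1985BackgroundPropagators, (3.20)–(3.21) p.394; Balaban1985RegularSpaces, (1.146) p.101, p.77] -/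
theorem mem_orthogonal_rangeSubPer_of_multiplier (hτt : ∀ a b : 𝔸, τ (a * b) = τ (b * a))
    (hUu : ∀ (x : Site d) (κ : Fin d), U₀ x κ ∈ unitaryUnits 𝔸) (hU : IsPeriodic P U₀) (hP : L ^ m ∣ P)
    {φ : Site d → 𝔸} (hφ : IsPeriodic P φ) {μ : ℕ → Site d → 𝔸} (hμ : ∀ x ∈ box (d := d) P, covLap η U₀ φ x = QT L m Λs U₀ μ x) :
    (⟨φ, hφ⟩ : perSub (𝔸 := 𝔸) (d := d) P) ∈ (formPer τ P).orthogonal (rangeSubPer P L m η Λs U₀) := by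
  rw [LinearMap.BilinForm.mem_orthogonal_iff]
  intro w hw
  induction hw using Submodule.span_induction with
  | mem w hw =>
    obtain ⟨lam, ⟨hsa, hper, hQ⟩, hwlam⟩ := hw
    show formPer τ P w _ = 0
    rw [formPer_apply]
    have key := sum_box_pair_covLap_eq_zero_of_multiplier ((LinearMap.mul ℝ 𝔸).compr₂ (τ.restrictScalars ℝ)) ⊤
      (fun u _ a b => by simpa using trace_mul_conjR τ hτt u a b) (fun _ _ => Subgroup.mem_top _) (fun _ _ _ => Subgroup.mem_top _)
      hU hP hφ hμ hper hQ
    have key' : ∑ x ∈ box (d := d) P, τ (covLap η U₀ lam x * φ x) = 0 := by simpa using key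
    have hre := congrArg Complex.re key'
    rw [Complex.re_sum, Complex.zero_re] at hre
    rw [← hre]
    refine Finset.sum_congr rfl fun x _ => ?_
    rw [hwlam, star_covLap_of_isSelfAdjoint η hUu hsa]
  | zero =>
    show formPer τ P 0 _ = 0
    rw [map_zero, LinearMap.zero_apply]
  | add w₁ w₂ _ _ h₁ h₂ =>
    show formPer τ P (w₁ + w₂) _ = 0
    have h₁' : formPer τ P w₁ _ = 0 := h₁
    have h₂' : formPer τ P w₂ _ = 0 := h₂
    rw [map_add, LinearMap.add_apply, h₁', h₂', add_zero]
  | smul c w _ hw =>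
    show formPer τ P (c • w) _ = 0
    have hw' : formPer τ P w _ = 0 := hw
    rw [map_smul, LinearMap.smul_apply, hw', smul_zero]

/-- ★ **`R^per(U₀)φ = 0` FOR A PERIODIC SOLUTION OF THE MULTIPLIER EQUATION** (faithful Hermitian tracial `τ`, f.d. fibre).
[cite: Balaban1985BackgroundPropagators, (3.20)–(3.22) p.394; Balaban1985RegularSpaces, (1.146) p.101, p.77] -/
theorem projRPer_eq_zero_of_multiplier [FiniteDimensional ℝ 𝔸] (hτt : ∀ a b : 𝔸, τ (a * b) = τ (b * a))
    (hτs : ∀ a : 𝔸, τ (star a) = starRingEnd ℂ (τ a)) (hτp : ∀ a : 𝔸, a ≠ 0 → 0 < (τ (star a * a)).re)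
    (hUu : ∀ (x : Site d) (κ : Fin d), U₀ x κ ∈ unitaryUnits 𝔸) (hU : IsPeriodic P U₀) (hP : L ^ m ∣ P)
    {φ : Site d → 𝔸} (hφ : IsPeriodic P φ) {μ : ℕ → Site d → 𝔸} (hμ : ∀ x ∈ box (d := d) P, covLap η U₀ φ x = QT L m Λs U₀ μ x) :
    projRPer τ P L m η Λs U₀ φ = 0 := by
  have heq : (⟨perRestrict P φ, perRestrict_mem_perSub P _⟩ : perSub (𝔸 := 𝔸) (d := d) P) = ⟨φ, hφ⟩ :=
    Subtype.ext (perRestrict_eq_self P hφ)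
  rw [projRPer, heq, projEPer_apply_of_mem_orthogonal L m η Λs U₀ hτs hτp (mem_orthogonal_rangeSubPer_of_multiplier hτt hUu hU hP hφ hμ)]
  rfl

/-- ★★ **THE SOURCE ENTERS THROUGH THE PROJECTION: `R^per(U₀)D^{η*}_{U₀}A = R^per(U₀)f`** under [B8] Thm 8's Landau relation with source (1.146) at
`Ω₀ = ℤᵈ` — «`Δ^η_{U₀}(𝟙_{Ω₀}(D^{η*}_{U₀}A − f)) = Q′(U₀)ᵀμ` on `Ω₀`» — for periodic `U₀` (unitary), `A`, `f`, `Lᵐ ∣ P`: `φ = D*A − f` is periodic and solves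
the multiplier equation, so `R^per φ = 0`, and `R^per` is linear. [cite: Balaban1985RegularSpaces, Thm 8 + (1.146) p.101, (1.42) p.83; Balaban1985BackgroundPropagators, (3.20)–(3.22) p.394, (3.26) p.395] -/
theorem projRPer_covDivB_eq_projRPer_of_src [FiniteDimensional ℝ 𝔸] (hτt : ∀ a b : 𝔸, τ (a * b) = τ (b * a))
    (hτs : ∀ a : 𝔸, τ (star a) = starRingEnd ℂ (τ a)) (hτp : ∀ a : 𝔸, a ≠ 0 → 0 < (τ (star a * a)).re)
    (hUu : ∀ (x : Site d) (κ : Fin d), U₀ x κ ∈ unitaryUnits 𝔸) (hU : IsPeriodic P U₀) (hP : L ^ m ∣ P)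
    {A : Site d → Fin d → 𝔸} (hA : IsPeriodic P A) {f : Site d → 𝔸} (hf : IsPeriodic P f) {Ω₀ : Set (Site d)} (hΩ₀ : Ω₀ = Set.univ)
    (hcl : ∃ μ : ℕ → Site d → 𝔸, ∀ x ∈ Ω₀, covLap η U₀ (Ω₀.indicator (covDivB η U₀ A - f)) x = QT L m Λs U₀ μ x) :
    projRPer τ P L m η Λs U₀ (covDivB η U₀ A) = projRPer τ P L m η Λs U₀ f := by
  subst hΩ₀
  obtain ⟨μ, hμ⟩ := hcl
  have hφ : IsPeriodic P (covDivB η U₀ A - f) :=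
    (perSub (𝔸 := 𝔸) (d := d) P).sub_mem (B9Eq321LandauProjectionZdPer.isPeriodic_covDivB hU hA) hf
  have hμ' : ∀ x ∈ box (d := d) P, covLap η U₀ (covDivB η U₀ A - f) x = QT L m Λs U₀ μ x := fun x _ => by
    have h := hμ x (Set.mem_univ x)
    rwa [Set.indicator_univ] at h
  have h0 := projRPer_eq_zero_of_multiplier hτt hτs hτp hUu hU hP hφ hμ'
  have hlin : projRPer τ P L m η Λs U₀ (covDivB η U₀ A - f) = projRPer τ P L m η Λs U₀ (covDivB η U₀ A) - projRPer τ P L m η Λs U₀ f := by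
    rw [← projRPerLin_apply, ← projRPerLin_apply, ← projRPerLin_apply, map_sub]
  rw [hlin] at h0
  exact sub_eq_zero.1 h0

/-- **THE RECORD'S SOURCE LETTER**: under (1.146) at a member with `i.Ω 0 = ℤᵈ`, `(D R^per D* A)(⟨x, x+e_μ⟩) = (D^η_{U₀,μ} R^per(U₀) f)(x)` for the genuine torus
record `opsAllZdPer`. [cite: Balaban1985BackgroundPropagators, (3.26) p.395, (3.20)–(3.22) p.394; Balaban1985RegularSpaces, (1.146) p.101, (1.58) p.86] -/
theorem DRDs_opsAllZdPer_eq_of_src [FiniteDimensional ℝ 𝔸] (τ : 𝔸 →ₗ[ℂ] ℂ) (hτt : ∀ a b : 𝔸, τ (a * b) = τ (b * a))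
    (hτs : ∀ a : 𝔸, τ (star a) = starRingEnd ℂ (τ a)) (hτp : ∀ a : 𝔸, a ≠ 0 → 0 < (τ (star a * a)).re)
    (ΛbP : ℕ → ℕ → Set (Site d × Fin d)) (ops₀ : ℝ → ZdIdx d L → ℕ → OpsZd d 𝔸) (M : ℝ) (i : ZdIdx d L) (hΩ : i.Ω 0 = Set.univ) (hP : L ^ m ∣ P)
    (hUu : ∀ (x : Site d) (κ : Fin d), U₀ x κ ∈ unitaryUnits 𝔸) (hU : IsPeriodic P U₀)
    {A : Site d → Fin d → 𝔸} (hA : IsPeriodic P A) {f : Site d → 𝔸} (hf : IsPeriodic P f)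
    (hcl : ∃ μ : ℕ → Site d → 𝔸, ∀ x ∈ i.Ω 0, covLap i.η U₀ ((i.Ω 0).indicator (covDivB i.η U₀ A - f)) x = QT L m (i.Λs m) U₀ μ x)
    (x : Site d) (μ : Fin d) :
    (opsAllZdPer τ L P ΛbP ops₀ M i m).DRDs U₀ A x μ = covDerivFwd i.η U₀ μ (projRPer τ P L m i.η (i.Λs m) U₀ f) x := by
  rw [opsAllZdPer_DRDs, projRPer_covDivB_eq_projRPer_of_src hτt hτs hτp hUu hU hP hA hf hΩ hcl]

end Source

/-! ## §3  The size of the source letter `D R^per(U₀) f` -/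

section Size

variable (τ : 𝔸 →ₗ[ℂ] ℂ) (P : ℕ) {L : ℕ} [NeZero P] [NeZero L]

omit [NeZero P] [NeZero L] in
/-- `‖f(x)‖ ≤ η⁻²·|f|₍₋₂₎` for `x ∈ Ω₀` (the level-`0` weight of [B8]'s `|·|₍₋₂₎` is `η²`; bounded family). [cite: Balaban1985RegularSpaces, (1.55) p.86, (1.146) p.101] -/
theorem norm_le_of_bdd_neg_two {k : ℕ} {η : ℝ} (hη : 0 < η) {Ω : ℕ → Set (Site d)} {f : Site d → 𝔸}
    (hfB : Bdd L k η (-(2 : ℝ)) (fun j (x : Site d) => x ∈ Ω j) f) {x : Site d} (hx : x ∈ Ω 0) :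
    ‖f x‖ ≤ (η ^ 2)⁻¹ * msup L k η (-(2 : ℝ)) (fun j (x : Site d) => x ∈ Ω j) f := by
  have h := B8ScaledSupNorm.weight_mul_norm_le_msup hfB (Nat.zero_le k) (i := x) hx
  have e2 : (-(2 : ℝ)) = -((2 : ℕ) : ℝ) := by norm_num
  rw [e2, B8ScaledSupNorm.weight_neg_natCast, pow_zero, one_mul] at h
  rw [le_inv_mul_iff₀ (by positivity : (0 : ℝ) < η ^ 2)]
  exact h

variable {U₀ : Site d → Fin d → 𝔸ˣ}

omit [NeZero L] in
/-- ★ **POINTWISE SIZE OF `D^η_{U₀,μ} R^per(U₀) f`**: `≤ η⁻¹·2·max{1, PᵈC_τ∕κ}·F` for unitary `U₀` and `‖f‖ ≤ F` (§1 + `|D^η_μ g| ≤ η⁻¹(|g(x+e_μ)| + |g(x)|)`).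
[cite: Balaban1985BackgroundPropagators, (3.26) p.395, (3.21)–(3.22) p.394, (3.4) p.391] -/
theorem norm_covDerivFwd_projRPer_le [FiniteDimensional ℝ 𝔸] [Nontrivial 𝔸] (hτs : ∀ a : 𝔸, τ (star a) = starRingEnd ℂ (τ a))
    (hτp : ∀ a : 𝔸, a ≠ 0 → 0 < (τ (star a * a)).re) {Cτ : ℝ} (hCτ : ∀ x y : 𝔸, |(τ (star x * y)).re| ≤ Cτ * ‖x‖ * ‖y‖)
    {κ : ℝ} (hκ : 0 < κ) (hκle : ∀ a : 𝔸, κ * ‖a‖ ^ 2 ≤ (τ (star a * a)).re) {η : ℝ} (hη : 0 < η)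
    (hUu : ∀ (x : Site d) (κ : Fin d), U₀ x κ ∈ unitaryUnits 𝔸) (L m : ℕ) (Λs : ℕ → Set (Site d)) (f : Site d → 𝔸) {F : ℝ} (hF : ∀ x, ‖f x‖ ≤ F)
    (μ : Fin d) (x : Site d) :
    ‖covDerivFwd η U₀ μ (projRPer τ P L m η Λs U₀ f) x‖ ≤ η⁻¹ * (2 * (max 1 (((box (d := d) P).card : ℝ) * Cτ / κ) * F)) := by
  refine (norm_covDerivFwd_le hη (unitaryUnits_le_U1 (hUu x μ)) _).trans (mul_le_mul_of_nonneg_left ?_ (inv_nonneg.2 hη.le))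
  have h1 := norm_projRPer_le τ P hτs hτp hCτ hκ hκle L m η Λs U₀ f hF (x + e μ)
  have h2 := norm_projRPer_le τ P hτs hτp hCτ hκ hκle L m η Λs U₀ f hF x
  linarith

/-- ★★ **THE SOURCE LETTER IN THE `|·|₍₋₃₎` NORM AT A MEMBER WITH `Ω_j = ℤᵈ`**: under (1.146), for the genuine torus record,
`|D R^per(U₀) D* A|₍₋₃₎ ≤ 2·max{1, PᵈC_τ∕κ}·(Lᵐ)³·|f|₍₋₂₎` (`U₀` unitary periodic, `A`, `f` periodic, `f` bounded in `|·|₍₋₂₎`, `Lᵐ ∣ P`, `1 ≤ L`).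
[cite: Balaban1985BackgroundPropagators, (3.26) p.395, (3.42) p.397, (3.20)–(3.22) p.394; Balaban1985RegularSpaces, (1.146) p.101, (1.58) p.86, (1.55) p.86, p.77] -/
theorem bondNorm_DRDs_le_of_src [FiniteDimensional ℝ 𝔸] [Nontrivial 𝔸] (hτt : ∀ a b : 𝔸, τ (a * b) = τ (b * a))
    (hτs : ∀ a : 𝔸, τ (star a) = starRingEnd ℂ (τ a)) (hτp : ∀ a : 𝔸, a ≠ 0 → 0 < (τ (star a * a)).re)
    {Cτ : ℝ} (hCτ : ∀ x y : 𝔸, |(τ (star x * y)).re| ≤ Cτ * ‖x‖ * ‖y‖) {κ : ℝ} (hκ : 0 < κ) (hκle : ∀ a : 𝔸, κ * ‖a‖ ^ 2 ≤ (τ (star a * a)).re)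
    (hL : 1 ≤ L) (ΛbP : ℕ → ℕ → Set (Site d × Fin d)) (ops₀ : ℝ → ZdIdx d L → ℕ → OpsZd d 𝔸) (M : ℝ) {i : ZdIdx d L} (hΩ : ∀ j, i.Ω j = Set.univ)
    {m : ℕ} (hP : L ^ m ∣ P) (hUu : ∀ (x : Site d) (κ : Fin d), U₀ x κ ∈ unitaryUnits 𝔸) (hU : IsPeriodic P U₀)
    {A : Site d → Fin d → 𝔸} (hA : IsPeriodic P A) {f : Site d → 𝔸} (hf : IsPeriodic P f)
    (hfB : Bdd L i.k i.η (-(2 : ℝ)) (fun j (x : Site d) => x ∈ i.Ω j) f)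
    (hcl : ∃ μ : ℕ → Site d → 𝔸, ∀ x ∈ i.Ω 0, covLap i.η U₀ ((i.Ω 0).indicator (covDivB i.η U₀ A - f)) x = QT L m (i.Λs m) U₀ μ x) :
    bondNorm L m i.η (-(3 : ℝ)) i.Ω (fun x μ => (opsAllZdPer τ L P ΛbP ops₀ M i m).DRDs U₀ A x μ) ≤
      2 * max 1 (((box (d := d) P).card : ℝ) * Cτ / κ) * ((L : ℝ) ^ m) ^ 3 * msup L i.k i.η (-(2 : ℝ)) (fun j (x : Site d) => x ∈ i.Ω j) f := by
  have hη : 0 < i.η := i.hη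
  have hLr : (1 : ℝ) ≤ L := by exact_mod_cast hL
  set K : ℝ := max 1 (((box (d := d) P).card : ℝ) * Cτ / κ) with hK
  set Nf : ℝ := msup L i.k i.η (-(2 : ℝ)) (fun j (x : Site d) => x ∈ i.Ω j) f with hNf
  have hK0 : 0 ≤ K := le_trans zero_le_one (le_max_left _ _)
  have hNf0 : 0 ≤ Nf := B8ScaledSupNorm.msup_nonneg L i.k hη.le _ _ _
  have hF : ∀ x, ‖f x‖ ≤ (i.η ^ 2)⁻¹ * Nf := fun x => norm_le_of_bdd_neg_two hη hfB (by rw [hΩ 0]; exact Set.mem_univ x)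
  have hpt : ∀ (x : Site d) (μ : Fin d), ‖(opsAllZdPer τ L P ΛbP ops₀ M i m).DRDs U₀ A x μ‖ ≤ i.η⁻¹ * (2 * (K * ((i.η ^ 2)⁻¹ * Nf))) := by
    intro x μ
    rw [DRDs_opsAllZdPer_eq_of_src τ hτt hτs hτp ΛbP ops₀ M i (hΩ 0) hP hUu hU hA hf hcl x μ]
    exact norm_covDerivFwd_projRPer_le τ P hτs hτp hCτ hκ hκle hη hUu L m (i.Λs m) f hF μ x
  refine B8ScaledSupNorm.msup_le (by positivity) fun j hj b _ => ?_
  have e3 : (-(3 : ℝ)) = -((3 : ℕ) : ℝ) := by norm_num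
  rw [e3, B8ScaledSupNorm.weight_neg_natCast]
  have hw : ((L : ℝ) ^ j * i.η) ^ 3 ≤ ((L : ℝ) ^ m * i.η) ^ 3 :=
    pow_le_pow_left₀ (by positivity) (mul_le_mul_of_nonneg_right (pow_le_pow_right₀ hLr hj) hη.le) 3
  calc ((L : ℝ) ^ j * i.η) ^ 3 * ‖(opsAllZdPer τ L P ΛbP ops₀ M i m).DRDs U₀ A b.1 b.2‖
      ≤ ((L : ℝ) ^ m * i.η) ^ 3 * (i.η⁻¹ * (2 * (K * ((i.η ^ 2)⁻¹ * Nf)))) := mul_le_mul hw (hpt b.1 b.2) (norm_nonneg _) (by positivity)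
    _ = 2 * K * ((L : ℝ) ^ m) ^ 3 * Nf * (i.η ^ 3 * i.η⁻¹ * (i.η ^ 2)⁻¹) := by ring
    _ = 2 * K * ((L : ℝ) ^ m) ^ 3 * Nf := by rw [show i.η ^ 3 * i.η⁻¹ * (i.η ^ 2)⁻¹ = 1 by field_simp, mul_one]

end Size

/-! ## §4  Source binders from the global-block binder, for the genuine record at a member with `Ω_j = ℤᵈ` -/

section Binders

variable (τ : 𝔸 →ₗ[ℂ] ℂ) (L P : ℕ) [NeZero P] [NeZero L] [FiniteDimensional ℝ 𝔸] [Nontrivial 𝔸]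

omit [NeZero L] [FiniteDimensional ℝ 𝔸] [Nontrivial 𝔸] in
/-- **a periodic bond field is uniformly bounded** (by the sum of its norms over one cell and all directions). [cite: Balaban1985RegularSpaces, p.77 («Ω_j = T_η»)] -/
theorem norm_le_sum_cell_of_isPeriodic {J : Site d → Fin d → 𝔸} (hJ : IsPeriodic P J) (y : Site d) (μ : Fin d) :
    ‖J y μ‖ ≤ ∑ κ : Fin d, ∑ ξ : Fin d → ZMod P, ‖J (tlift ξ) κ‖ :=
  calc ‖J y μ‖ ≤ ∑ ξ : Fin d → ZMod P, ‖J (tlift ξ) μ‖ := B9B8KnitHolderZeroOfGlob.norm_le_sum_box_of_isPeriodic (isPeriodic_apply_dir hJ μ) y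
    _ ≤ ∑ κ : Fin d, ∑ ξ : Fin d → ZMod P, ‖J (tlift ξ) κ‖ :=
        Finset.single_le_sum (f := fun κ : Fin d => ∑ ξ : Fin d → ZMod P, ‖J (tlift ξ) κ‖)
          (fun _ _ => Finset.sum_nonneg fun _ _ => norm_nonneg _) (Finset.mem_univ μ)

/-- ★★★ **`GlobAtIPer ⟹ SrcAtIPer` FOR THE GENUINE TORUS RECORD AT A MEMBER WITH `Ω_j = ℤᵈ`**: the source term is `G(U₀)S` with `S = D R^per D* A = D R^per f ∈
E_𝔤^per(P)` (§2, g22's `DRDs_mem_domSubHPer`), so (3.47)@−3 for `G` (the binder, at `J := S`) and §3's `|S|₍₋₃₎ ≤ 2K(Lᵐ)³|f|₍₋₂₎` give the three lines with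
`c_S = B₀·2K(Lᵐ)³`, `K = max{1, PᵈC_τ∕κ}`; the uniform bound is periodicity of `G(U₀)S`. Threshold `a_S = a_T`.
[cite: Balaban1985BackgroundPropagators, (3.47) p.398, (3.42) p.397, (3.26)–(3.27) p.395, (3.20)–(3.22) p.394; Balaban1985RegularSpaces, Thm 8 + (1.146) p.101, (1.58) p.86, p.92, p.77] -/
theorem srcAtIPer_of_globAtIPer_univ (hτt : ∀ a b : 𝔸, τ (a * b) = τ (b * a)) (hτs : ∀ a : 𝔸, τ (star a) = starRingEnd ℂ (τ a))
    (hτp : ∀ a : 𝔸, a ≠ 0 → 0 < (τ (star a * a)).re) {Cτ : ℝ} (hCτ : ∀ x y : 𝔸, |(τ (star x * y)).re| ≤ Cτ * ‖x‖ * ‖y‖)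
    {κ : ℝ} (hκ : 0 < κ) (hκle : ∀ a : 𝔸, κ * ‖a‖ ^ 2 ≤ (τ (star a * a)).re) (hL : 1 ≤ L)
    (ΛbP : ℕ → ℕ → Set (Site d × Fin d)) (ops₀ : ℝ → ZdIdx d L → ℕ → OpsZd d 𝔸) {M : ℝ} {i : ZdIdx d L} (hΩ : ∀ j, i.Ω j = Set.univ)
    {m : ℕ} (hP : L ^ m ∣ P) {aT B₀ : ℝ} (hB₀ : 0 ≤ B₀) (h : GlobAtIPer P L (opsAllZdPer τ L P ΛbP ops₀) aT B₀ M i m) :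
    SrcAtIPer P L (opsAllZdPer τ L P ΛbP ops₀) aT (B₀ * (2 * max 1 (((box (d := d) P).card : ℝ) * Cτ / κ) * ((L : ℝ) ^ m) ^ 3)) M i m := by
  intro α₀ U₀ hU₀ hper hα hαT hIn A hAp _ _ f hfp _ hfB hcl
  set o : OpsZd d 𝔸 := opsAllZdPer τ L P ΛbP ops₀ M i m with ho
  set S : Site d → Fin d → 𝔸 := fun z κ => o.DRDs U₀ A z κ with hS_def
  have hS : S ∈ domSubHPer (d := d) (𝔸 := 𝔸) P := DRDs_mem_domSubHPer τ P hτs hτp (withDpZd (withQQP τ L ΛbP ops₀)) M i m hU₀ hper A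
  obtain ⟨h1, h2, h4⟩ := h α₀ U₀ hU₀ hper hα hαT hIn S hS
  have hSN : bondNorm L m i.η (-(3 : ℝ)) i.Ω S ≤
      2 * max 1 (((box (d := d) P).card : ℝ) * Cτ / κ) * ((L : ℝ) ^ m) ^ 3 * msup L i.k i.η (-(2 : ℝ)) (fun j (x : Site d) => x ∈ i.Ω j) f :=
    bondNorm_DRDs_le_of_src τ P hτt hτs hτp hCτ hκ hκle hL ΛbP ops₀ M hΩ hP hU₀ hper hAp hfp hfB hcl
  have hB : B₀ * bondNorm L m i.η (-(3 : ℝ)) i.Ω S ≤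
      B₀ * (2 * max 1 (((box (d := d) P).card : ℝ) * Cτ / κ) * ((L : ℝ) ^ m) ^ 3) * msup L i.k i.η (-(2 : ℝ)) (fun j (x : Site d) => x ∈ i.Ω j) f := by
    rw [mul_assoc]; exact mul_le_mul_of_nonneg_left hSN hB₀
  have hGp : IsPeriodic P (o.Gop U₀ S) := gop_isPeriodic_opsAllZdPer' τ ΛbP ops₀ M i m U₀ S
  exact ⟨⟨∑ κ : Fin d, ∑ ξ : Fin d → ZMod P, ‖o.Gop U₀ S (tlift ξ) κ‖, fun y μ => norm_le_sum_cell_of_isPeriodic P hGp y μ⟩,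
    h1.trans hB, h2.trans hB, h4.trans hB⟩

/-- ★★★ **`GlobAtIPer ⟹ SrcHolderAtIH2Per` FOR THE GENUINE TORUS RECORD AT A MEMBER WITH `Ω_j = ℤᵈ`** (`0 ≤ β`, integer lengths `len v ≥ 1` when `len v > 0`,
`2 ≤ d`): FILE 3's Hölder-from-global knit (`C_β = 2B₀(Lᵐ)^β`, both-points class = first-point class at `Ω_j = ℤᵈ`) at `J := S = D R^per f`, §3's size of
`S`, and the boundedness of the Hölder family from the periodicity of `D G(U₀)S`: `c_Sβ = 2B₀(Lᵐ)^β·2K(Lᵐ)³`.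
[cite: Balaban1985BackgroundPropagators, (3.45), (3.43) p.398, (3.40) p.397, (3.26) p.395; Balaban1985RegularSpaces, Thm 8 + (1.146) p.101, (1.59) p.86, (1.39) p.82, p.77] -/
theorem srcHolderAtIH2Per_of_globAtIPer_univ (hd2 : 2 ≤ d) (hτt : ∀ a b : 𝔸, τ (a * b) = τ (b * a)) (hτs : ∀ a : 𝔸, τ (star a) = starRingEnd ℂ (τ a))
    (hτp : ∀ a : 𝔸, a ≠ 0 → 0 < (τ (star a * a)).re) {Cτ : ℝ} (hCτ : ∀ x y : 𝔸, |(τ (star x * y)).re| ≤ Cτ * ‖x‖ * ‖y‖)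
    {κ : ℝ} (hκ : 0 < κ) (hκle : ∀ a : 𝔸, κ * ‖a‖ ^ 2 ≤ (τ (star a * a)).re) (hL : 1 ≤ L)
    (ΛbP : ℕ → ℕ → Set (Site d × Fin d)) (ops₀ : ℝ → ZdIdx d L → ℕ → OpsZd d 𝔸) {M : ℝ} {i : ZdIdx d L} (hΩ : ∀ j, i.Ω j = Set.univ)
    {m : ℕ} (hP : L ^ m ∣ P) {aT B₀ : ℝ} (hB₀ : 0 ≤ B₀) {β : ℝ} (hβ : 0 ≤ β) {len : Site d → ℝ} (hlen : ∀ v : Site d, 0 < len v → 1 ≤ len v)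
    (h : GlobAtIPer P L (opsAllZdPer τ L P ΛbP ops₀) aT B₀ M i m) :
    SrcHolderAtIH2Per P L (opsAllZdPer τ L P ΛbP ops₀) aT
      (2 * B₀ * (((L : ℝ) ^ m) ^ β) * (2 * max 1 (((box (d := d) P).card : ℝ) * Cτ / κ) * ((L : ℝ) ^ m) ^ 3)) β len M i m := by
  intro α₀ U₀ hU₀ hper hα hαT hIn A hAp _ _ f hfp _ hfB hcl
  have hη : 0 < i.η := i.hη
  have hLr : (1 : ℝ) ≤ L := by exact_mod_cast hL
  set o : OpsZd d 𝔸 := opsAllZdPer τ L P ΛbP ops₀ M i m with ho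
  set S : Site d → Fin d → 𝔸 := fun z κ => o.DRDs U₀ A z κ with hS_def
  have hS : S ∈ domSubHPer (d := d) (𝔸 := 𝔸) P := DRDs_mem_domSubHPer τ P hτs hτp (withDpZd (withQQP τ L ΛbP ops₀)) M i m hU₀ hper A
  have hGper : ∀ (U₀ : Site d → Fin d → 𝔸ˣ) (J : Site d → Fin d → 𝔸), IsPeriodic P U₀ → J ∈ domSubHPer (d := d) (𝔸 := 𝔸) P →
      IsPeriodic P ((opsAllZdPer τ L P ΛbP ops₀ M i m).Gop U₀ J) := fun U₀ J _ _ => gop_isPeriodic_opsAllZdPer' τ ΛbP ops₀ M i m U₀ J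
  have hhol := B9Thm33GlobalBlockWitnessZdPer.holderAtIPer_of_globAtIPer_of_len (P := P) hd2 hL hΩ hB₀ hGper hβ hlen h
  have hhol2 : HolderAtIH2Per P L (opsAllZdPer τ L P ΛbP ops₀) aT (2 * B₀ * (((L : ℝ) ^ m) ^ β)) β len M i m :=
    (B9SupplySockB9P3ZdH2Per.holderAtIH2Per_iff_holderAtIPer_of_univ P L hΩ).2 hhol
  have h5 := hhol2 α₀ U₀ hU₀ hper hα hαT hIn S hS
  have hSN : bondNorm L m i.η (-(3 : ℝ)) i.Ω S ≤
      2 * max 1 (((box (d := d) P).card : ℝ) * Cτ / κ) * ((L : ℝ) ^ m) ^ 3 * msup L i.k i.η (-(2 : ℝ)) (fun j (x : Site d) => x ∈ i.Ω j) f :=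
    bondNorm_DRDs_le_of_src τ P hτt hτs hτp hCτ hκ hκle hL ΛbP ops₀ M hΩ hP hU₀ hper hAp hfp hfB hcl
  have hCβ0 : 0 ≤ 2 * B₀ * (((L : ℝ) ^ m) ^ β) := by
    have : 0 ≤ ((L : ℝ) ^ m) ^ β := Real.rpow_nonneg (by positivity) β
    positivity
  refine ⟨?_, h5.trans (by rw [mul_assoc (2 * B₀ * (((L : ℝ) ^ m) ^ β))]; exact mul_le_mul_of_nonneg_left hSN hCβ0)⟩
  -- boundedness of the Hölder family: `D G(U₀)S` is periodic, hence bounded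
  set G : Site d → Fin d → 𝔸 := o.Gop U₀ S with hG
  have hGp : IsPeriodic P G := gop_isPeriodic_opsAllZdPer' τ ΛbP ops₀ M i m U₀ S
  set c : ℝ := ∑ κ : Fin d, ∑ ξ : Fin d → ZMod P, ‖G (tlift ξ) κ‖ with hc
  have hGb : ∀ (y : Site d) (κ : Fin d), ‖G y κ‖ ≤ c := fun y κ => norm_le_sum_cell_of_isPeriodic P hGp y κ
  have hc0 : 0 ≤ c := (norm_nonneg _).trans (hGb 0 ⟨0, lt_of_lt_of_le (by norm_num) hd2⟩)
  have hU1 : ∀ y κ, U₀ y κ ∈ U1 𝔸 := fun y κ => unitaryUnits_le_U1 (hU₀ y κ)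
  have hFb : ∀ (ν κ : Fin d) (x : Site d), ‖covDerivFwd i.η U₀ ν (fun z => G z κ) x‖ ≤ i.η⁻¹ * (c + c) := fun ν κ x =>
    (norm_covDerivFwd_le hη (hU1 x ν) _).trans (mul_le_mul_of_nonneg_left (add_le_add (hGb _ _) (hGb _ _)) (inv_nonneg.2 hη.le))
  refine B8ScaledSupNorm.bdd_of_forall (c := ((L : ℝ) ^ m * i.η) ^ (2 + β) * ((i.η⁻¹ * (c + c) + i.η⁻¹ * (c + c)) * (i.η ^ β)⁻¹))
    fun j hj q hq => ?_
  obtain ⟨ν, κ, x, x'⟩ := q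
  have hq0 : 0 ≤ hquot i.η β len U₀ (covDerivFwd i.η U₀ ν fun z => G z κ) (x, x') := hquot_nonneg hη.le β U₀ _ hq.1
  rw [Real.norm_of_nonneg hq0]
  have hs0 : 0 < (L : ℝ) ^ j * i.η := by positivity
  have hsm : (L : ℝ) ^ j * i.η ≤ (L : ℝ) ^ m * i.η := mul_le_mul_of_nonneg_right (pow_le_pow_right₀ hLr hj) hη.le
  have hwle : weight L i.η (-(2 + β)) j ≤ ((L : ℝ) ^ m * i.η) ^ (2 + β) := by
    simp only [weight, neg_neg]
    exact Real.rpow_le_rpow hs0.le hsm (by linarith)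
  have hηβ : 0 < i.η ^ β := Real.rpow_pos_of_pos hη β
  have hden : i.η ^ β ≤ (i.η * len ((x, x').2 - (x, x').1)) ^ β := by
    apply Real.rpow_le_rpow hη.le _ hβ
    have := hlen _ hq.1.1
    nlinarith
  have hnum : ‖trans U₀ (x, x').1 (x, x').2 ((covDerivFwd i.η U₀ ν fun z => G z κ) (x, x').2) - (covDerivFwd i.η U₀ ν fun z => G z κ) (x, x').1‖ ≤
      i.η⁻¹ * (c + c) + i.η⁻¹ * (c + c) :=
    calc _ ≤ ‖trans U₀ (x, x').1 (x, x').2 ((covDerivFwd i.η U₀ ν fun z => G z κ) (x, x').2)‖ + ‖(covDerivFwd i.η U₀ ν fun z => G z κ) (x, x').1‖ :=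
          norm_sub_le _ _
      _ ≤ i.η⁻¹ * (c + c) + i.η⁻¹ * (c + c) := by rw [B9Eq340HolderZd.norm_trans hU1]; exact add_le_add (hFb ν κ x') (hFb ν κ x)
  have hquo : hquot i.η β len U₀ (covDerivFwd i.η U₀ ν fun z => G z κ) (x, x') ≤ (i.η⁻¹ * (c + c) + i.η⁻¹ * (c + c)) * (i.η ^ β)⁻¹ := by
    rw [B9Eq340HolderZd.hquot_def, div_eq_mul_inv]
    exact mul_le_mul hnum (inv_anti₀ hηβ hden) (inv_nonneg.2 (Real.rpow_nonneg (mul_nonneg hη.le hq.1.1.le) β)) (by positivity)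
  exact mul_le_mul hwle hquo hq0 (Real.rpow_nonneg (hs0.le.trans hsm) _)

end Binders

/-! ## §5  At the torus member: the source binders are theorems, and T6e's sourced socket is fully fed -/

section Torus

variable [FiniteDimensional ℝ 𝔸] [Nontrivial 𝔸] (τ : 𝔸 →ₗ[ℂ] ℂ) (hτp : ∀ a : 𝔸, a ≠ 0 → 0 < (τ (star a * a)).re)
  (hτt : ∀ a b : 𝔸, τ (a * b) = τ (b * a)) (hτs : ∀ a : 𝔸, τ (star a) = starRingEnd ℂ (τ a)) {L P : ℕ} [NeZero P] [NeZero L]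

include hτp hτt hτs in
/-- ★★★★ **THE FIVE ANALYTIC BINDERS OF THE SOURCED SOCKET FOR THE GENUINE RECORD AT THE TORUS MEMBER, ONE THRESHOLD** (`2 ≤ d`, `2 ≤ L`, `Lᵐ ∣ P`, `0 ≤ β`,
integer lengths): `∃ aI aT B₀ > 0, K ≥ 1` with `InvAtHIPer aI` (Thm 3.11, FILE 2), `GlobAtIPer aT B₀` ((3.47)@−3, FILE 3), `HolderAtIH2Per aT (2B₀(Lᵐ)^β)` ((3.45)),
`SrcAtIPer aT (B₀·2K(Lᵐ)³)` and `SrcHolderAtIH2Per aT (2B₀(Lᵐ)^β·2K(Lᵐ)³)` ((3.42)₃ ∕ (3.43) for the source term) — NO binder of Bałaban's left; per torus.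
[cite: Balaban1985BackgroundPropagators, Thm 3.11 p.416, Thm 3.3 p.399, (3.42) p.397, (3.43)–(3.47) p.398, (3.20)–(3.22) p.394, (3.26)–(3.27) p.395; Balaban1985RegularSpaces, Thm 8 + (1.146) p.101, (1.58)–(1.59) p.86, p.77 («Ω_j = T_η»)] -/
theorem srcBinders_opsAllZdPer_torusIdx (hd2 : 2 ≤ d) (hL2 : 2 ≤ L) {Cτ : ℝ} (hCτ : ∀ x y : 𝔸, |(τ (star x * y)).re| ≤ Cτ * ‖x‖ * ‖y‖)
    (t : TorusMember) (ops₀ : ℝ → ZdIdx d L → ℕ → OpsZd d 𝔸) (M : ℝ) (m : ℕ) (hP : L ^ m ∣ P)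
    {β : ℝ} (hβ : 0 ≤ β) {len : Site d → ℝ} (hlen : ∀ v : Site d, 0 < len v → 1 ≤ len v) :
    ∃ aI : ℝ, 0 < aI ∧ ∃ aT : ℝ, 0 < aT ∧ ∃ B₀ : ℝ, 0 < B₀ ∧ ∃ K : ℝ, 1 ≤ K ∧
      InvAtHIPer P L (opsAllZdPer τ L P (fun m => torusLamb m) ops₀) aI M (torusIdx (d := d) (le_trans (by norm_num) hL2) t) m ∧
      GlobAtIPer P L (opsAllZdPer τ L P (fun m => torusLamb m) ops₀) aT B₀ M (torusIdx (d := d) (le_trans (by norm_num) hL2) t) m ∧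
      HolderAtIH2Per P L (opsAllZdPer τ L P (fun m => torusLamb m) ops₀) aT (2 * B₀ * (((L : ℝ) ^ m) ^ β)) β len M
        (torusIdx (d := d) (le_trans (by norm_num) hL2) t) m ∧
      SrcAtIPer P L (opsAllZdPer τ L P (fun m => torusLamb m) ops₀) aT (B₀ * (2 * K * ((L : ℝ) ^ m) ^ 3)) M
        (torusIdx (d := d) (le_trans (by norm_num) hL2) t) m ∧
      SrcHolderAtIH2Per P L (opsAllZdPer τ L P (fun m => torusLamb m) ops₀) aT (2 * B₀ * (((L : ℝ) ^ m) ^ β) * (2 * K * ((L : ℝ) ^ m) ^ 3)) β len M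
        (torusIdx (d := d) (le_trans (by norm_num) hL2) t) m := by
  have hL1 : 1 ≤ L := le_trans (by norm_num) hL2
  have hd : 0 < d := lt_of_lt_of_le (by norm_num) hd2
  obtain ⟨aI, haI, hinv⟩ := invAtHIPer_opsAllZdPer_torusIdx τ hτp hτt hτs hd hL2 t ops₀ M m hP
  obtain ⟨aT, haT, B₀, hB₀, hglob⟩ := globAtIPer_opsAllZdPer_torusIdx τ hτp hτt hτs hd hL2 hCτ t ops₀ M m hP
  obtain ⟨κ, hκ, hκle⟩ := exists_norm_sq_le_re_trace τ hτp
  have hΩ : ∀ j, (torusIdx (d := d) hL1 t).Ω j = Set.univ := fun _ => rfl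
  refine ⟨aI, haI, aT, haT, B₀, hB₀, max 1 (((box (d := d) P).card : ℝ) * Cτ / κ), le_max_left _ _, hinv, hglob, ?_, ?_, ?_⟩
  · exact (B9SupplySockB9P3ZdH2Per.holderAtIH2Per_iff_holderAtIPer_of_univ P L hΩ).2
      (B9Thm33GlobalBlockWitnessZdPer.holderAtIPer_of_globAtIPer_of_len (P := P) hd2 hL1 hΩ hB₀.le
        (fun U₀ J _ _ => gop_isPeriodic_opsAllZdPer' τ (fun m => torusLamb (d := d) m) ops₀ M _ m U₀ J) hβ hlen hglob)
  · exact srcAtIPer_of_globAtIPer_univ τ L P hτt hτs hτp hCτ hκ hκle hL1 (fun m => torusLamb m) ops₀ hΩ hP hB₀.le hglob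
  · exact srcHolderAtIH2Per_of_globAtIPer_univ τ L P hd2 hτt hτs hτp hCτ hκ hκle hL1 (fun m => torusLamb m) ops₀ hΩ hP hB₀.le hβ hlen hglob

include hτp hτt hτs in
/-- ★★★★★ **dag-n05-c T6e's GUARDED SOURCED SOCKET `SB9srcH2Per` FOR THE GENUINE TORUS RECORD AT THE TORUS MEMBER, FULLY FED** (`2 ≤ d`, `2 ≤ L`, `Lᵏ ∣ P` for
the member's truncation `k = tm.k`, `1 ≤ M`, `0 ≤ β`, integer lengths, any `γ`): `∃ aI aT B₀ > 0, C_β c_S c_Sβ ≥ 0` such that T6e's hypothesis text holds for the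
one-member family `ι := torusIdx tm`, `p := P`, class `torusLamb`, constants `cP = min{1∕16, aI, aT, aT, 1∕(2B₀·14(d−1)·M+1)}`, `B₀′ = max{1, 2B₀max{1,q}}`,
`B₀β′ = 2max{0,C_β}max{1,q}`, `γ″ = 2c_Sγ∕B₀′`, `γβ = (max{0,C_β}c_S∕B₀ + c_Sβ)γ`, `q = qQ d L C_τ β_τ 0` — FILE 5 §4 on the binders above.  NO binder of
Bałaban's left; constants per torus (WATCH-QUAL-SOCKET-TORUS). [cite: Balaban1985RegularSpaces, Thm 8 + (1.146) p.101, (1.58)–(1.59) p.86, Prop. 3 p.87, p.77 («Ω_j = T_η»); Balaban1985BackgroundPropagators, Thm 3.3 p.399, (3.42) p.397, (3.43)–(3.47) p.398, Thm 3.11 p.416, (3.27) p.395] -/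
theorem sockB9P3srcH2Per_genuine_torusIdx (hd2 : 2 ≤ d) (hL2 : 2 ≤ L) {Cτ : ℝ} (hCτ : ∀ x y : 𝔸, |(τ (star x * y)).re| ≤ Cτ * ‖x‖ * ‖y‖)
    (tm : TorusMember) (ops₀ : ℝ → ZdIdx d L → ℕ → OpsZd d 𝔸) {M : ℝ} (hM1 : 1 ≤ M) (hP : L ^ tm.k ∣ P)
    {β : ℝ} (hβ : 0 ≤ β) {len : Site d → ℝ} (hlen : ∀ v : Site d, 0 < len v → 1 ≤ len v) (γ : ℝ) :
    ∃ aI : ℝ, 0 < aI ∧ ∃ aT : ℝ, 0 < aT ∧ ∃ B₀ : ℝ, 0 < B₀ ∧ ∃ Cβ : ℝ, 0 ≤ Cβ ∧ ∃ cS : ℝ, 0 ≤ cS ∧ ∃ cSβ : ℝ, 0 ≤ cSβ ∧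
      ∀ α₀ α₁ α₂ : ℝ, 0 < α₀ →
        α₀ ≤ min (1 / 16) (min aI (min aT (min aT (1 / (2 * B₀ * (14 * ((d - 1 : ℕ) : ℝ)) * M + 1))))) → 0 < α₁ → 0 < α₂ →
        α₂ ≤ min (1 / 16) (min aI (min aT (min aT (1 / (2 * B₀ * (14 * ((d - 1 : ℕ) : ℝ)) * M + 1))))) →
        ∀ (U₀ W : Site d → Fin d → 𝔸ˣ), (∀ x κ, U₀ x κ ∈ unitaryUnits 𝔸) → (∀ x κ, W x κ ∈ unitaryUnits 𝔸) →
        IsPeriodic P U₀ → IsPeriodic P W →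
        ∀ f : Site d → 𝔸, IsPeriodic P f → InR138 L (torusIdx (d := d) (le_trans (by norm_num) hL2) tm).k (torusIdx (d := d) (le_trans (by norm_num) hL2) tm).η ((torusIdx (d := d) (le_trans (by norm_num) hL2) tm).Ω 0) ((torusIdx (d := d) (le_trans (by norm_num) hL2) tm).Λs (torusIdx (d := d) (le_trans (by norm_num) hL2) tm).k) U₀ f →
        (∀ x, IsSelfAdjoint (f x)) → (∀ x, x ∉ (torusIdx (d := d) (le_trans (by norm_num) hL2) tm).Ω 0 → f x = 0) →
        Bdd L (torusIdx (d := d) (le_trans (by norm_num) hL2) tm).k (torusIdx (d := d) (le_trans (by norm_num) hL2) tm).η (-(2 : ℝ)) (fun j (x : Site d) => x ∈ (torusIdx (d := d) (le_trans (by norm_num) hL2) tm).Ω j) f →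
        msup L (torusIdx (d := d) (le_trans (by norm_num) hL2) tm).k (torusIdx (d := d) (le_trans (by norm_num) hL2) tm).η (-(2 : ℝ)) (fun j (x : Site d) => x ∈ (torusIdx (d := d) (le_trans (by norm_num) hL2) tm).Ω j) f < γ * (α₀ + α₁) →
        msup L (torusIdx (d := d) (le_trans (by norm_num) hL2) tm).k (torusIdx (d := d) (le_trans (by norm_num) hL2) tm).η (-(3 : ℝ)) (fun j (p : Fin d × Site d) => p.2 ∈ (torusIdx (d := d) (le_trans (by norm_num) hL2) tm).Ω j) (fun p => covDerivFwd (torusIdx (d := d) (le_trans (by norm_num) hL2) tm).η U₀ p.1 f p.2) < γ * (α₀ + α₁) →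
        InAk L (torusIdx (d := d) (le_trans (by norm_num) hL2) tm).k (torusIdx (d := d) (le_trans (by norm_num) hL2) tm).η α₀ (torusIdx (d := d) (le_trans (by norm_num) hL2) tm).Ω U₀ → InAk L (torusIdx (d := d) (le_trans (by norm_num) hL2) tm).k (torusIdx (d := d) (le_trans (by norm_num) hL2) tm).η α₀ (torusIdx (d := d) (le_trans (by norm_num) hL2) tm).Ω (mulCfg W U₀) → IsLandau146W L (torusIdx (d := d) (le_trans (by norm_num) hL2) tm).k (torusIdx (d := d) (le_trans (by norm_num) hL2) tm).η ((torusIdx (d := d) (le_trans (by norm_num) hL2) tm).Ω 0) ((torusIdx (d := d) (le_trans (by norm_num) hL2) tm).Λs (torusIdx (d := d) (le_trans (by norm_num) hL2) tm).k) U₀ f W →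
        ∀ A' : Site d → Fin d → 𝔸, (∀ y τ, IsSelfAdjoint (A' y τ)) → IsPeriodic P A' →
        (∀ j, j ≤ (torusIdx (d := d) (le_trans (by norm_num) hL2) tm).k → ∀ (y : Site d) (τ : Fin d), SideTouches ((torusIdx (d := d) (le_trans (by norm_num) hL2) tm).Ω j) y τ →
          W y τ = cfgExp (torusIdx (d := d) (le_trans (by norm_num) hL2) tm).η A' y τ ∧ ‖A' y τ‖ ≤ α₂ * ((L : ℝ) ^ j * (torusIdx (d := d) (le_trans (by norm_num) hL2) tm).η)⁻¹) →
        (∀ (y : Site d) (τ : Fin d), (∀ j, j ≤ (torusIdx (d := d) (le_trans (by norm_num) hL2) tm).k → ¬ SideTouches ((torusIdx (d := d) (le_trans (by norm_num) hL2) tm).Ω j) y τ) → A' y τ = 0) →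
        msup L (torusIdx (d := d) (le_trans (by norm_num) hL2) tm).k (torusIdx (d := d) (le_trans (by norm_num) hL2) tm).η (-(1 : ℝ)) (fun j (b : Site d × Fin d) => SideTouches ((torusIdx (d := d) (le_trans (by norm_num) hL2) tm).Ω j) b.1 b.2) (fun b => A' b.1 b.2)
            ≤ max 1 (2 * B₀ * max 1 (qQ d L Cτ (betaTau τ) 0)) * (bondNorm L (torusIdx (d := d) (le_trans (by norm_num) hL2) tm).k (torusIdx (d := d) (le_trans (by norm_num) hL2) tm).η (-(3 : ℝ)) (torusIdx (d := d) (le_trans (by norm_num) hL2) tm).Ω (fun x μ => Jcur (torusIdx (d := d) (le_trans (by norm_num) hL2) tm).η U₀ A' μ x)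
              + wsup 1 (fun p : {p : ℕ × (Site d × Fin d) // p.1 ≤ (torusIdx (d := d) (le_trans (by norm_num) hL2) tm).k ∧ p.2 ∈ torusLamb (torusIdx (d := d) (le_trans (by norm_num) hL2) tm).k p.1} =>
                  linCovIter L U₀ (iEta (torusIdx (d := d) (le_trans (by norm_num) hL2) tm).η A') p.1.1 p.1.2.1 p.1.2.2))
              + (2 * cS * γ / max 1 (2 * B₀ * max 1 (qQ d L Cτ (betaTau τ) 0))) * max 1 (2 * B₀ * max 1 (qQ d L Cτ (betaTau τ) 0)) * (α₀ + α₁) ∧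
          msup L (torusIdx (d := d) (le_trans (by norm_num) hL2) tm).k (torusIdx (d := d) (le_trans (by norm_num) hL2) tm).η (-(2 : ℝ)) (fun j (t : Fin d × Fin d × Site d) => SideTouches ((torusIdx (d := d) (le_trans (by norm_num) hL2) tm).Ω j) t.2.2 t.2.1)
              (fun t => covDerivFwd (torusIdx (d := d) (le_trans (by norm_num) hL2) tm).η U₀ t.1 (fun z => A' z t.2.1) t.2.2)
            ≤ max 1 (2 * B₀ * max 1 (qQ d L Cτ (betaTau τ) 0)) * (bondNorm L (torusIdx (d := d) (le_trans (by norm_num) hL2) tm).k (torusIdx (d := d) (le_trans (by norm_num) hL2) tm).η (-(3 : ℝ)) (torusIdx (d := d) (le_trans (by norm_num) hL2) tm).Ω (fun x μ => Jcur (torusIdx (d := d) (le_trans (by norm_num) hL2) tm).η U₀ A' μ x)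
              + wsup 1 (fun p : {p : ℕ × (Site d × Fin d) // p.1 ≤ (torusIdx (d := d) (le_trans (by norm_num) hL2) tm).k ∧ p.2 ∈ torusLamb (torusIdx (d := d) (le_trans (by norm_num) hL2) tm).k p.1} =>
                  linCovIter L U₀ (iEta (torusIdx (d := d) (le_trans (by norm_num) hL2) tm).η A') p.1.1 p.1.2.1 p.1.2.2))
              + (2 * cS * γ / max 1 (2 * B₀ * max 1 (qQ d L Cτ (betaTau τ) 0))) * max 1 (2 * B₀ * max 1 (qQ d L Cτ (betaTau τ) 0)) * (α₀ + α₁) ∧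
          bondNorm L (torusIdx (d := d) (le_trans (by norm_num) hL2) tm).k (torusIdx (d := d) (le_trans (by norm_num) hL2) tm).η (-(3 : ℝ)) (torusIdx (d := d) (le_trans (by norm_num) hL2) tm).Ω (fun x μ => pdiv (torusIdx (d := d) (le_trans (by norm_num) hL2) tm).η U₀ (plaqCovDeriv (torusIdx (d := d) (le_trans (by norm_num) hL2) tm).η U₀ A') μ x)
            ≤ max 1 (2 * B₀ * max 1 (qQ d L Cτ (betaTau τ) 0)) * (bondNorm L (torusIdx (d := d) (le_trans (by norm_num) hL2) tm).k (torusIdx (d := d) (le_trans (by norm_num) hL2) tm).η (-(3 : ℝ)) (torusIdx (d := d) (le_trans (by norm_num) hL2) tm).Ω (fun x μ => Jcur (torusIdx (d := d) (le_trans (by norm_num) hL2) tm).η U₀ A' μ x)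
              + wsup 1 (fun p : {p : ℕ × (Site d × Fin d) // p.1 ≤ (torusIdx (d := d) (le_trans (by norm_num) hL2) tm).k ∧ p.2 ∈ torusLamb (torusIdx (d := d) (le_trans (by norm_num) hL2) tm).k p.1} =>
                  linCovIter L U₀ (iEta (torusIdx (d := d) (le_trans (by norm_num) hL2) tm).η A') p.1.1 p.1.2.1 p.1.2.2))
              + (2 * cS * γ / max 1 (2 * B₀ * max 1 (qQ d L Cτ (betaTau τ) 0))) * max 1 (2 * B₀ * max 1 (qQ d L Cτ (betaTau τ) 0)) * (α₀ + α₁) ∧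
          bondNorm L (torusIdx (d := d) (le_trans (by norm_num) hL2) tm).k (torusIdx (d := d) (le_trans (by norm_num) hL2) tm).η (-(3 : ℝ)) (torusIdx (d := d) (le_trans (by norm_num) hL2) tm).Ω (fun x μ => covLap (torusIdx (d := d) (le_trans (by norm_num) hL2) tm).η U₀ (fun z => A' z μ) x)
            ≤ max 1 (2 * B₀ * max 1 (qQ d L Cτ (betaTau τ) 0)) * (bondNorm L (torusIdx (d := d) (le_trans (by norm_num) hL2) tm).k (torusIdx (d := d) (le_trans (by norm_num) hL2) tm).η (-(3 : ℝ)) (torusIdx (d := d) (le_trans (by norm_num) hL2) tm).Ω (fun x μ => Jcur (torusIdx (d := d) (le_trans (by norm_num) hL2) tm).η U₀ A' μ x)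
              + wsup 1 (fun p : {p : ℕ × (Site d × Fin d) // p.1 ≤ (torusIdx (d := d) (le_trans (by norm_num) hL2) tm).k ∧ p.2 ∈ torusLamb (torusIdx (d := d) (le_trans (by norm_num) hL2) tm).k p.1} =>
                  linCovIter L U₀ (iEta (torusIdx (d := d) (le_trans (by norm_num) hL2) tm).η A') p.1.1 p.1.2.1 p.1.2.2))
              + (2 * cS * γ / max 1 (2 * B₀ * max 1 (qQ d L Cτ (betaTau τ) 0))) * max 1 (2 * B₀ * max 1 (qQ d L Cτ (betaTau τ) 0)) * (α₀ + α₁) ∧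
          msup L (torusIdx (d := d) (le_trans (by norm_num) hL2) tm).k (torusIdx (d := d) (le_trans (by norm_num) hL2) tm).η (-(2 + β)) (fun j (q : Fin d × Fin d × (Site d × Site d)) => q.2.2 ∈ AdmPair (torusIdx (d := d) (le_trans (by norm_num) hL2) tm).η len ∧ q.2.2.1 ∈ (torusIdx (d := d) (le_trans (by norm_num) hL2) tm).Ω j ∧ q.2.2.2 ∈ (torusIdx (d := d) (le_trans (by norm_num) hL2) tm).Ω j)
              (fun q => hquot (torusIdx (d := d) (le_trans (by norm_num) hL2) tm).η β len U₀ (covDerivFwd (torusIdx (d := d) (le_trans (by norm_num) hL2) tm).η U₀ q.1 (fun z => A' z q.2.1)) q.2.2)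
            ≤ (2 * max 0 Cβ * max 1 (qQ d L Cτ (betaTau τ) 0)) * (bondNorm L (torusIdx (d := d) (le_trans (by norm_num) hL2) tm).k (torusIdx (d := d) (le_trans (by norm_num) hL2) tm).η (-(3 : ℝ)) (torusIdx (d := d) (le_trans (by norm_num) hL2) tm).Ω (fun x μ => Jcur (torusIdx (d := d) (le_trans (by norm_num) hL2) tm).η U₀ A' μ x)
              + wsup 1 (fun p : {p : ℕ × (Site d × Fin d) // p.1 ≤ (torusIdx (d := d) (le_trans (by norm_num) hL2) tm).k ∧ p.2 ∈ torusLamb (torusIdx (d := d) (le_trans (by norm_num) hL2) tm).k p.1} =>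
                  linCovIter L U₀ (iEta (torusIdx (d := d) (le_trans (by norm_num) hL2) tm).η A') p.1.1 p.1.2.1 p.1.2.2)) + ((max 0 Cβ * cS / B₀ + cSβ) * γ) * (α₀ + α₁) := by
  have hL1 : 1 ≤ L := le_trans (by norm_num) hL2
  obtain ⟨aI, haI, aT, haT, B₀, hB₀, K, hK1, hinv, hglob, hhol, hsrc, hsrcH⟩ :=
    srcBinders_opsAllZdPer_torusIdx τ hτp hτt hτs hd2 hL2 hCτ tm ops₀ M (torusIdx (d := d) hL1 tm).k hP hβ hlen
  have hK0 : 0 ≤ K := zero_le_one.trans hK1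
  have hrp : 0 ≤ ((L : ℝ) ^ (torusIdx (d := d) hL1 tm).k) ^ β := Real.rpow_nonneg (by positivity) β
  refine ⟨aI, haI, aT, haT, B₀, hB₀, 2 * B₀ * (((L : ℝ) ^ (torusIdx (d := d) hL1 tm).k) ^ β), by positivity,
    B₀ * (2 * K * ((L : ℝ) ^ (torusIdx (d := d) hL1 tm).k) ^ 3), by positivity,
    2 * B₀ * (((L : ℝ) ^ (torusIdx (d := d) hL1 tm).k) ^ β) * (2 * K * ((L : ℝ) ^ (torusIdx (d := d) hL1 tm).k) ^ 3), by positivity, ?_⟩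
  exact sockB9P3srcH2Per_opsAllZdPer_of_binders L τ hd2 hL2 hτp hτt hτs hCτ ops₀ hM1 (fun _ : Unit => torusIdx (d := d) hL1 tm) (fun _ => P)
    (fun _ => inferInstance) (fun _ => rfl) (fun _ m => torusLamb m) (fun _ => hP)
    (fun _ j _ κ => B9Thm311FlatPositivityZdPer.isPeriodic_mem_torusLamb (P / L ^ j) _ j κ)
    (fun _ => B9Thm33GlobalBlockWitnessZdPer.levelSepPP0_torusIdx' hL1 tm _)
    (fun _ => hinv) (fun _ => hglob) (fun _ => hhol) (fun _ => hsrc) (fun _ => hsrcH) hB₀ (by positivity) (by positivity) ()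

end Torus

end Literature.MathematicalPhysics.QuantumFieldTheory.Balaban1983to89.B9Thm33SourceWitnessZdPer
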